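import Summits.QuantumFields.BalabanUV.T4Continuum.Support.NE7ConstrainedGreenSymmetricCarrier
import Summits.QuantumFields.BalabanUV.T4Continuum.Spine.NE3.QbarRightInverseB8
import HarnessLib

/-!
# NE7SoftOperatorInverses — THE POSITIVITY LETTER ALONE YIELDS BOTH INVERSES: from «`softSymOpK` is POSITIVE DEFINITE» ([B9] Thm 3.11's statement for `Δ_a(U)`, on our carrier)
# the Green operator `G = softSymOpK⁻¹` (`softSymGreenK`) and the inverse `(Qbar G Qbar*)⁻¹` (`softSymDinvK`) EXIST — `softSymOpK` is symmetric, an injective endomorphism of a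
# finite-dimensional space is invertible, and `Qbar` is SURJECTIVE on the skew torus 1-forms (row NE3's exact right inverse `QbarRightInverseB8.QbarIter_covLift_solveW`), so
# `Qbar*` is injective and `Qbar G Qbar*` is positive definite; Bałaban's constrained propagator `C_a(W) := G − GQbar*(QbarGQbar*)⁻¹QbarG` (`cGreenSymK`) is then a NAMED operator
# and (KL-B) in source form follows from positivity + its value∕curl rows + the bootstrap line (file 127 of the curved (APE), F198)

Cell `pub-balaban`, rung (B)+1 sub-cell t4, lineage `b2b-balaban-t4-ne7-p1` (CRUX PROVER NE7 #1 = OWNER of row NE7), generation 85; memo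
`t4/b2b-balaban-t4-ne7-p1-g85/LAGRANGE-CARRIER.md` §8.  Over F192 `NE7BalabanSoftOperator`, F196 `NE7ConstrainedGreenSymmetricCarrier.sourceLetter_of_symmetric_rows`, row NE3's
`Spine/NE3/QbarRightInverseB8` (`QbarIter_covLift_solveW`, `covLift_solveW_skew`, `covLift_solveW_periodic`) BY NAME, and Mathlib's `LinearEquiv.ofBijective`.
WHAT ([folklore]; DATA definitions `invOfInjective` (generic), `softSymGreenK`, `softSymDinvK`, `cGreenSymK` + theorems; 0 sorry).  §1 generic finite-dimensional facts:
`injective_of_posDef`, `invOfInjective` (+ `invOfInjective_apply_self`, `self_invOfInjective_apply`), `adjoint_injective_of_surjective'`, `posDef_comp_inv_adjoint`.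
§2 `softSymOpK_symm` (self-adjointness: `hessSym_symm`, the orthogonal projection `landauProjK` is symmetric, `Qbar*Qbar`).  §3 **`qbarOpK_surjective`** (`L ≥ 2`, `cruxC·M²·x < 1`: row NE3's
exact right inverse).  §4 the named inverses `softSymGreenK`, `softSymDinvK` and **`cGreenSymK`** with `softSymGreenK_apply_softSymOpK`, `softSymDinvK_apply`.  §5
**`sourceLetter_of_posDef_rows`** — F173's `hSrc` at `Gauge := IsLandauB8` (constant `2K`) from: `softSymOpK` positive definite (Thm 3.11 TYPE), the sup-value row `K₀` and sup-curl row `K` of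
`cGreenSymK` (Thm 3.3 (3.42)₁,₂∕(3.49) TYPE), the tension letter `τ` and `2·card n·τ·K₀ ≤ 1`.
HONEST FRAMING (page 1): finite-dimensional linear algebra; NO estimate; positivity and the rows are DISPLAYED HYPOTHESES (NOT proved; identification with print's operators through
lit-balaban's junction modules NOT made here); (KL-B) at curved `W` NOT proved; (APE) on curved data NOT proved; NOT ONE-STEP, NOT NE7; spine 0∕9; finite T⁴ rung (B)+1 — NOT infinite
volume, NOT mass gap, NOT `BetaPertH`, NOT Clay.  Continuum YM on T⁴ ⇐ BetaPertH ∧ nine spine estimates (0/9 proved); BetaPertH ⇐ (D1) ∧ (D4) ∧ CAP+tail; G-an2-4 gates asym, D1 and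
NE2/3/4.
-/

set_option autoImplicit false

open scoped BigOperators InnerProductSpace Matrix Matrix.Norms.L2Operator
open Finset

namespace Summit.QuantumFields.BalabanUV.T4Continuum.NE7SoftOperatorInverses

open Literature.MathematicalPhysics.QuantumFieldTheory.Balaban1983to89
open B7Prop1Explicit B7Prop2Explicit UnitaryModel
open T4AveragingDeficitWall (IsUnitaryCfg IsSkewDir SmallField curlAt dirL1)
open T4AveragingDeficitWallBoundary (periodBox IsPeriodicCfg)
open AveragingDeficitPeriodicCounting (IsPeriodicDir)
open AveragingDeficitMultiLevelPrep (LevelSmall tower)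
open AveragingDeficitTwoLevelPrep (skewSub)
open AveragingDeficitTorusChart (TDir extDir)
open MinimalActionLevels (perWin)
open NE3HessForm (hess dAction)
open NE3EnergyHessBilin (hessSym_symm)
open NE3TangentCovariantTower (QbarIter)
open NE3HilbertSchmidtTorus
open NE3.PairLandauB8 (IsLandauB8)
open NE3CovariantLift (covLift)
open NE3QbarIterCovLiftPrep (cruxC)
open NE3FramePotBoundW (tower_eq_pow_mul)
open NE3SmoothRightInverseW (solveW resSkew)
open NE3.QbarRightInverseB8 (QbarIter_covLift_solveW covLift_solveW_skew covLift_solveW_periodic)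
open NE7FlatSliceSourceDuality (srcPair)
open NE7ConstrainedGreenIdentity (constrainedGreen)
open NE7BalabanSoftOperator
open NE7ConstrainedGreenSymmetricCarrier (sourceLetter_of_symmetric_rows)

noncomputable section

/-! ## §1 Generic finite-dimensional facts -/

section Generic

variable {V F : Type*} [NormedAddCommGroup V] [InnerProductSpace ℝ V] [FiniteDimensional ℝ V]
  [NormedAddCommGroup F] [InnerProductSpace ℝ F] [FiniteDimensional ℝ F]

omit [FiniteDimensional ℝ V] in
/-- A positive definite endomorphism is injective. [folklore] -/
theorem injective_of_posDef (S : V →ₗ[ℝ] V) (hpos : ∀ v : V, v ≠ 0 → 0 < ⟪v, S v⟫_ℝ) : Function.Injective S := by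
  refine (injective_iff_map_eq_zero S).mpr fun v hv => ?_
  by_contra hne
  have h := hpos v hne
  rw [hv, inner_zero_right] at h
  exact lt_irrefl _ h

/-- **THE INVERSE OF AN INJECTIVE ENDOMORPHISM** of a finite-dimensional space (injective ⟹ bijective). A DATA definition. [folklore] -/
def invOfInjective (S : V →ₗ[ℝ] V) (hS : Function.Injective S) : V →ₗ[ℝ] V :=
  (LinearEquiv.ofBijective S ⟨hS, LinearMap.injective_iff_surjective.mp hS⟩).symm.toLinearMap

/-- `S⁻¹ (S y) = y`. [folklore] -/
theorem invOfInjective_apply_self (S : V →ₗ[ℝ] V) (hS : Function.Injective S) (y : V) : invOfInjective S hS (S y) = y :=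
  (LinearEquiv.ofBijective S ⟨hS, LinearMap.injective_iff_surjective.mp hS⟩).symm_apply_apply y

/-- `S (S⁻¹ y) = y`. [folklore] -/
theorem self_invOfInjective_apply (S : V →ₗ[ℝ] V) (hS : Function.Injective S) (y : V) : S (invOfInjective S hS y) = y :=
  (LinearEquiv.ofBijective S ⟨hS, LinearMap.injective_iff_surjective.mp hS⟩).apply_symm_apply y

/-- The adjoint of a SURJECTIVE map between finite-dimensional real Hilbert spaces is injective. [folklore] -/
theorem adjoint_injective_of_surjective' (Q : V →ₗ[ℝ] F) (hQ : Function.Surjective Q) :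
    Function.Injective (LinearMap.adjoint (𝕜 := ℝ) (E := V) (F := F) Q : F →ₗ[ℝ] V) := by
  refine (injective_iff_map_eq_zero _).mpr fun f hf => ?_
  obtain ⟨b, hb⟩ := hQ f
  have h : ⟪f, f⟫_ℝ = 0 := by
    calc ⟪f, f⟫_ℝ = ⟪Q b, f⟫_ℝ := by rw [hb]
      _ = ⟪b, (LinearMap.adjoint (𝕜 := ℝ) (E := V) (F := F) Q : F →ₗ[ℝ] V) f⟫_ℝ := (LinearMap.adjoint_inner_right _ _ _).symm
      _ = 0 := by rw [hf, inner_zero_right]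
  exact inner_self_eq_zero.mp h

/-- **`Qbar G Qbar*` IS POSITIVE DEFINITE** when `S` is symmetric positive definite, `G = S⁻¹`, and `Qbar` is surjective: `⟪f, QGQ*f⟫ = ⟪w, Sw⟫` with `w = GQ*f ≠ 0`. [folklore] -/
theorem posDef_comp_inv_adjoint (S : V →ₗ[ℝ] V) (hsymm : ∀ v w : V, ⟪S v, w⟫_ℝ = ⟪v, S w⟫_ℝ) (hpos : ∀ v : V, v ≠ 0 → 0 < ⟪v, S v⟫_ℝ)
    (Q : V →ₗ[ℝ] F) (hQ : Function.Surjective Q) (f : F) (hf : f ≠ 0) :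
    0 < ⟪f, Q (invOfInjective S (injective_of_posDef S hpos) ((LinearMap.adjoint (𝕜 := ℝ) (E := V) (F := F) Q : F →ₗ[ℝ] V) f))⟫_ℝ := by
  set G := invOfInjective S (injective_of_posDef S hpos) with hG
  set v := (LinearMap.adjoint (𝕜 := ℝ) (E := V) (F := F) Q : F →ₗ[ℝ] V) f with hv
  have hv0 : v ≠ 0 := fun h => hf (adjoint_injective_of_surjective' Q hQ (by rw [← hv, h, map_zero]))
  have hw0 : G v ≠ 0 := fun h => hv0 (by rw [← self_invOfInjective_apply S (injective_of_posDef S hpos) v, ← hG, h, map_zero])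
  rw [← LinearMap.adjoint_inner_left, ← hv]
  have hSG : S (G v) = v := by rw [hG]; exact self_invOfInjective_apply S (injective_of_posDef S hpos) v
  have h1 : ⟪v, G v⟫_ℝ = ⟪G v, S (G v)⟫_ℝ := by
    nth_rw 1 [← hSG]
    exact hsymm _ _
  rw [h1]
  exact hpos _ hw0

end Generic

/-! ## §2 `softSymOpK` is symmetric -/

variable {d : ℕ} {n : Type*} [Fintype n] [DecidableEq n]

section Carrier

variable [Nonempty n] {L N : ℕ} [NeZero N] (hL : 1 ≤ L) (j : ℕ) [NeZero (N * L ^ (j + 1))]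
  {W : Site d → Fin d → (Matrix n n ℂ)ˣ} {x : ℝ} (hWu : IsUnitaryCfg W) (hWP : IsPeriodicCfg W ((N * L ^ (j + 1) : ℕ) : ℤ))
  (hx : 0 ≤ x) (hs : LevelSmall d L j x) (hWx : SmallField W x)

/-- **`softSymOpK` IS SELF-ADJOINT**: the symmetrised Hessian operator, `D_W R(W) D_W*` with the orthogonal projection `R(W)`, and `M⁻²Qbar*Qbar` are each symmetric. [folklore] -/
theorem softSymOpK_symm (b c : skewForms d n (N * L ^ (j + 1))) :
    ⟪softSymOpK hL j hWu hx hs hWx b, c⟫_ℝ = ⟪b, softSymOpK (N := N) hL j hWu hx hs hWx c⟫_ℝ := by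
  rw [softSymOpK_apply, softSymOpK_apply, inner_add_left, inner_add_left, inner_add_right, inner_add_right]
  refine congrArg₂ (· + ·) (congrArg₂ (· + ·) ?_ ?_) ?_
  · rw [inner_hessSymOpK_left, real_inner_comm, inner_hessSymOpK_left, add_comm]
  · rw [← LinearMap.adjoint_inner_right (gradOpK hWu (N * L ^ (j + 1))), inner_landauProjK_left, ← LinearMap.adjoint_inner_left (gradOpK hWu (N * L ^ (j + 1)))]
  · rw [LinearMap.adjoint_inner_left, LinearMap.smul_apply, LinearMap.id_apply, LinearMap.smul_apply, LinearMap.id_apply, LinearMap.adjoint_inner_right,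
      real_inner_smul_left, real_inner_smul_right]

/-! ## §3 `Qbar` is surjective on the skew torus 1-forms (row NE3's exact right inverse) -/

include hWP in
/-- **`qbarOpK` IS SURJECTIVE** (`L ≥ 2`, `cruxC·(L^{j+1})²·x < 1`): row NE3's covariant lift of the solved datum is an exact right inverse of `QbarIter L (j+1) W` on skew `N`-periodic
coarse fields (`QbarRightInverseB8.QbarIter_covLift_solveW`), skew and `(N·L^{j+1})`-periodic. [folklore] -/
theorem qbarOpK_surjective (hL2 : 2 ≤ L) (hθ : cruxC d L * (((L : ℝ) ^ (j + 1)) ^ 2 * x) < 1) :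
    Function.Surjective (qbarOpK (N := N) hL j hWu hx hs hWx) := by
  intro m
  have hT : ((tower L N (j + 1) : ℕ) : ℤ) = ((N * L ^ (j + 1) : ℕ) : ℤ) := by rw [tower_eq_pow_mul, Nat.mul_comm]
  have hWP' : IsPeriodicCfg W ((tower L N (j + 1) : ℕ) : ℤ) := by rw [hT]; exact hWP
  have hφ : IsSkewDir (extF N (m : Form d n N)) := m.2
  have hφP : IsPeriodicDir (extF N (m : Form d n N)) (N : ℤ) := isPeriodicDir_extF _ _
  set Y := covLift (L ^ (j + 1)) W (extDir N ((solveW hL2 j hWu hx hs hWx N hθ (resSkew N hφ) : ↥(skewSub d n N)) : TDir d n N)) with hY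
  have hYQ : QbarIter L (j + 1) W Y = extF N (m : Form d n N) := QbarIter_covLift_solveW hL2 j hWu hWP' hx hs hWx hθ hφ hφP
  have hYs : IsSkewDir Y := covLift_solveW_skew hL2 j hWu hx hs hWx hθ hφ
  have hYP : IsPeriodicDir Y ((N * L ^ (j + 1) : ℕ) : ℤ) := covLift_solveW_periodic hL2 j hWu hWP' hx hs hWx hθ hφ
  refine ⟨⟨resF (N * L ^ (j + 1)) Y, resF_mem_skewForms hYs⟩, Subtype.ext ?_⟩
  rw [coe_qbarOpK, Submodule.coe_mk, extF_resF _ hYP, hYQ, resF_extF]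

/-! ## §4 The named inverses and Bałaban's constrained propagator `C_a(W)` -/

/-- **THE GREEN OPERATOR `G = softSymOpK⁻¹`** under positivity ([B9] Thm 3.11's statement as the hypothesis `hpos`). A DATA definition. [folklore] -/
def softSymGreenK (hpos : ∀ b : skewForms d n (N * L ^ (j + 1)), b ≠ 0 → 0 < ⟪b, softSymOpK (N := N) hL j hWu hx hs hWx b⟫_ℝ) :
    skewForms d n (N * L ^ (j + 1)) →ₗ[ℝ] skewForms d n (N * L ^ (j + 1)) :=
  invOfInjective _ (injective_of_posDef _ hpos)

/-- `G (S y) = y`. [folklore] -/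
theorem softSymGreenK_apply_softSymOpK (hpos : ∀ b : skewForms d n (N * L ^ (j + 1)), b ≠ 0 → 0 < ⟪b, softSymOpK (N := N) hL j hWu hx hs hWx b⟫_ℝ)
    (y : skewForms d n (N * L ^ (j + 1))) : softSymGreenK hL j hWu hx hs hWx hpos (softSymOpK hL j hWu hx hs hWx y) = y :=
  invOfInjective_apply_self _ _ y

/-- `S (G y) = y`. [folklore] -/
theorem softSymOpK_apply_softSymGreenK (hpos : ∀ b : skewForms d n (N * L ^ (j + 1)), b ≠ 0 → 0 < ⟪b, softSymOpK (N := N) hL j hWu hx hs hWx b⟫_ℝ)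
    (y : skewForms d n (N * L ^ (j + 1))) : softSymOpK hL j hWu hx hs hWx (softSymGreenK hL j hWu hx hs hWx hpos y) = y :=
  self_invOfInjective_apply _ _ y

include hWP in
/-- `Qbar G Qbar*` is positive definite under positivity of `S` (`L ≥ 2`, `cruxC·M²·x < 1` for the surjectivity of `Qbar`). [folklore] -/
theorem qbar_green_adjoint_pos (hL2 : 2 ≤ L) (hθ : cruxC d L * (((L : ℝ) ^ (j + 1)) ^ 2 * x) < 1)
    (hpos : ∀ b : skewForms d n (N * L ^ (j + 1)), b ≠ 0 → 0 < ⟪b, softSymOpK (N := N) hL j hWu hx hs hWx b⟫_ℝ) (f : skewForms d n N) (hf : f ≠ 0) :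
    0 < ⟪f, qbarOpK (N := N) hL j hWu hx hs hWx (softSymGreenK hL j hWu hx hs hWx hpos
      ((LinearMap.adjoint (𝕜 := ℝ) (E := skewForms d n (N * L ^ (j + 1))) (F := skewForms d n N) (qbarOpK (N := N) hL j hWu hx hs hWx)
            : skewForms d n N →ₗ[ℝ] skewForms d n (N * L ^ (j + 1))) f))⟫_ℝ := by
  have h := posDef_comp_inv_adjoint (V := skewForms d n (N * L ^ (j + 1))) (F := skewForms d n N) (softSymOpK hL j hWu hx hs hWx)
    (softSymOpK_symm hL j hWu hx hs hWx) hpos (qbarOpK (N := N) hL j hWu hx hs hWx) (qbarOpK_surjective hL j hWu hWP hx hs hWx hL2 hθ) f hf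
  unfold softSymGreenK
  exact h

include hWP in
/-- `Qbar G Qbar*` is injective under positivity. [folklore] -/
theorem injective_qbar_green_adjoint (hL2 : 2 ≤ L) (hθ : cruxC d L * (((L : ℝ) ^ (j + 1)) ^ 2 * x) < 1)
    (hpos : ∀ b : skewForms d n (N * L ^ (j + 1)), b ≠ 0 → 0 < ⟪b, softSymOpK (N := N) hL j hWu hx hs hWx b⟫_ℝ) :
    Function.Injective (qbarOpK (N := N) hL j hWu hx hs hWx ∘ₗ softSymGreenK hL j hWu hx hs hWx hpos
      ∘ₗ (LinearMap.adjoint (𝕜 := ℝ) (E := skewForms d n (N * L ^ (j + 1))) (F := skewForms d n N) (qbarOpK (N := N) hL j hWu hx hs hWx)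
            : skewForms d n N →ₗ[ℝ] skewForms d n (N * L ^ (j + 1)))) :=
  injective_of_posDef _ fun f hf => by
    simpa only [LinearMap.comp_apply] using qbar_green_adjoint_pos hL j hWu hWP hx hs hWx hL2 hθ hpos f hf

/-- **`(Qbar G Qbar*)⁻¹`** under positivity. A DATA definition. [folklore] -/
def softSymDinvK (hWP : IsPeriodicCfg W ((N * L ^ (j + 1) : ℕ) : ℤ)) (hL2 : 2 ≤ L) (hθ : cruxC d L * (((L : ℝ) ^ (j + 1)) ^ 2 * x) < 1)
    (hpos : ∀ b : skewForms d n (N * L ^ (j + 1)), b ≠ 0 → 0 < ⟪b, softSymOpK (N := N) hL j hWu hx hs hWx b⟫_ℝ) :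
    skewForms d n N →ₗ[ℝ] skewForms d n N :=
  invOfInjective _ (injective_qbar_green_adjoint hL j hWu hWP hx hs hWx hL2 hθ hpos)

/-- `Dinv (Qbar (G (Qbar* f))) = f`. [folklore] -/
theorem softSymDinvK_apply (hL2 : 2 ≤ L) (hθ : cruxC d L * (((L : ℝ) ^ (j + 1)) ^ 2 * x) < 1)
    (hpos : ∀ b : skewForms d n (N * L ^ (j + 1)), b ≠ 0 → 0 < ⟪b, softSymOpK (N := N) hL j hWu hx hs hWx b⟫_ℝ) (f : skewForms d n N) :
    softSymDinvK hL j hWu hx hs hWx hWP hL2 hθ hpos (qbarOpK (N := N) hL j hWu hx hs hWx (softSymGreenK hL j hWu hx hs hWx hpos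
      ((LinearMap.adjoint (𝕜 := ℝ) (E := skewForms d n (N * L ^ (j + 1))) (F := skewForms d n N) (qbarOpK (N := N) hL j hWu hx hs hWx)
            : skewForms d n N →ₗ[ℝ] skewForms d n (N * L ^ (j + 1))) f))) = f :=
  invOfInjective_apply_self _ (injective_qbar_green_adjoint hL j hWu hWP hx hs hWx hL2 hθ hpos) f

/-- **BAŁABAN's CONSTRAINED PROPAGATOR `C_a(W) = G − GQbar*(QbarGQbar*)⁻¹QbarG` ON OUR CARRIER** (the operator whose value∕gradient∕curl rows [B9] Thm 3.3 + (3.49) supply), under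
positivity. A DATA definition. [folklore] -/
def cGreenSymK (hWP : IsPeriodicCfg W ((N * L ^ (j + 1) : ℕ) : ℤ)) (hL2 : 2 ≤ L) (hθ : cruxC d L * (((L : ℝ) ^ (j + 1)) ^ 2 * x) < 1)
    (hpos : ∀ b : skewForms d n (N * L ^ (j + 1)), b ≠ 0 → 0 < ⟪b, softSymOpK (N := N) hL j hWu hx hs hWx b⟫_ℝ) :
    skewForms d n (N * L ^ (j + 1)) →ₗ[ℝ] skewForms d n (N * L ^ (j + 1)) :=
  constrainedGreen (softSymGreenK hL j hWu hx hs hWx hpos) (qbarOpK (N := N) hL j hWu hx hs hWx)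
    (LinearMap.adjoint (𝕜 := ℝ) (E := skewForms d n (N * L ^ (j + 1))) (F := skewForms d n N) (qbarOpK (N := N) hL j hWu hx hs hWx)
        : skewForms d n N →ₗ[ℝ] skewForms d n (N * L ^ (j + 1)))
    (softSymDinvK hL j hWu hx hs hWx hWP hL2 hθ hpos)

/-! ## §5 (KL-B) in source form from positivity + the rows of `C_a(W)` -/

include hWP in
/-- **(KL-B) IN SOURCE FORM FROM [B9] Thm 3.11 (positivity of `Δ_a(W)`) + Thm 3.3∕(3.49) (rows of `C_a(W)`) SHAPES ON OUR CARRIER.**  HYPOTHESES (displayed, NOT proved): `softSymOpK` positive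
definite; the sup-VALUE row `K₀` and the sup-CURL row `K` of `cGreenSymK`; the tension letter `τ` (a class theorem, `NE7TensionRadiusOfFluxGradient`) and `2·card n·τ·K₀ ≤ 1`.
CONCLUSION: F173's `hSrc` at `Gauge := IsLandauB8 L N (j+1) W` with constant `2K`. [folklore] -/
theorem sourceLetter_of_posDef_rows (hL2 : 2 ≤ L) (hθ : cruxC d L * (((L : ℝ) ^ (j + 1)) ^ 2 * x) < 1)
    (hpos : ∀ b : skewForms d n (N * L ^ (j + 1)), b ≠ 0 → 0 < ⟪b, softSymOpK (N := N) hL j hWu hx hs hWx b⟫_ℝ)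
    {τ : ℝ} (hτ : 0 ≤ τ)
    (hten : ∀ K : Site d → Fin d → Matrix n n ℂ, IsSkewDir K → IsPeriodicDir K ((N * L ^ (j + 1) : ℕ) : ℤ) →
      |dAction W K (perWin d (N * L ^ (j + 1)))| ≤ τ * dirL1 K (periodBox (d := d) (N * L ^ (j + 1))))
    {K₀ K : ℝ} (hK : 0 ≤ K)
    (hC0 : ∀ h : skewForms d n (N * L ^ (j + 1)), ∀ g : ℝ, (∀ (y : Site d) (κ : Fin d), ‖extF (N * L ^ (j + 1)) (h : Form d n (N * L ^ (j + 1))) y κ‖ ≤ g) →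
      ∀ (y : Site d) (κ : Fin d), ‖extF (N * L ^ (j + 1)) ((cGreenSymK hL j hWu hx hs hWx hWP hL2 hθ hpos h : skewForms d n (N * L ^ (j + 1))) : Form d n (N * L ^ (j + 1))) y κ‖ ≤ K₀ * g)
    (hC1 : ∀ h : skewForms d n (N * L ^ (j + 1)), ∀ g : ℝ, (∀ (y : Site d) (κ : Fin d), ‖extF (N * L ^ (j + 1)) (h : Form d n (N * L ^ (j + 1))) y κ‖ ≤ g) →
      ∀ (z : Site d) (μ' ν' : Fin d), μ' ≠ ν' →
        ‖curlAt W (extF (N * L ^ (j + 1)) ((cGreenSymK hL j hWu hx hs hWx hWP hL2 hθ hpos h : skewForms d n (N * L ^ (j + 1))) : Form d n (N * L ^ (j + 1)))) z μ' ν'‖ ≤ K * g)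
    (hsmall : 2 * (Fintype.card n * τ) * K₀ ≤ 1) :
    ∀ X'' : Site d → Fin d → Matrix n n ℂ, IsSkewDir X'' → IsPeriodicDir X'' ((N * L ^ (j + 1) : ℕ) : ℤ) → QbarIter L (j + 1) W X'' = 0 →
      IsLandauB8 (d := d) L N (j + 1) W X'' →
      ∀ H : Site d → Fin d → Matrix n n ℂ, IsSkewDir H → IsPeriodicDir H ((N * L ^ (j + 1) : ℕ) : ℤ) → ∀ g : ℝ, 0 ≤ g → (∀ (y : Site d) (κ : Fin d), ‖H y κ‖ ≤ g) →
      (∀ Y : Site d → Fin d → Matrix n n ℂ, IsSkewDir Y → IsPeriodicDir Y ((N * L ^ (j + 1) : ℕ) : ℤ) → QbarIter L (j + 1) W Y = 0 →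
        hess W X'' Y (perWin d (N * L ^ (j + 1))) = srcPair H Y (periodBox (d := d) (N * L ^ (j + 1)))) →
      ∀ (z : Site d) (μ' ν' : Fin d), μ' ≠ ν' → ‖curlAt W X'' z μ' ν'‖ ≤ (2 * K) * g :=
  sourceLetter_of_symmetric_rows hL j hWu hWP hx hs hWx hτ hten (softSymGreenK hL j hWu hx hs hWx hpos) (softSymGreenK_apply_softSymOpK hL j hWu hx hs hWx hpos)
    (softSymDinvK hL j hWu hx hs hWx hWP hL2 hθ hpos) (softSymDinvK_apply hL j hWu hWP hx hs hWx hL2 hθ hpos) hK hC0 hC1 hsmall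

end Carrier

end

end Summit.QuantumFields.BalabanUV.T4Continuum.NE7SoftOperatorInverses
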